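import Summits.BirchSwinnertonDyer.Rank1Residual.X10.MuTransferThreeOfFineBothRanks
import Summits.BirchSwinnertonDyer.Rank1Residual.X10.CasselsTatePairingCertificate
import HarnessLib

/-!
# N2's Ш-CELLS at `p = 3` on the F1 road: Miller's `BSD(E,3)` at a rank-`0` pair with `#Ш_an = 9` from
# F1 (the Euler-system UPPER half) and ONE exact `3`-descent `#Sel^(3)(E/ℚ) = 9` (the LOWER half) — no
# Cassels–Tate pairing certificate, no Cassels–Tate squareness, no Wuthrich, no image certificate
# (cell `b2b-bsdres`, unit `b2b-bsdres-x10` = N2 class lead, GEN 41; TOOL — theorems only, no definition, no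
# named fact, nothing booked)

HONEST FRAMING (run/shared/lean/b2b/bsd-rank1-residual/, verbatim in every file): the goal of the
cell is to DELETE the COMBINATION-SHAPED residual classes of the Birch–Swinnerton-Dyer formula for
ALL analytic-rank `≤ 1` elliptic curves over `ℚ` — "full BSD formula for every rank `≤ 1` curve in
class `C`" assembled STRICTLY from published theorems — so that the rank-`≤ 1` remainder becomes
exactly the CONSTRUCTION-SHAPED classes, which are TYPED (missing-input `Prop`s), NOT attempted.
This is not "finishing BSD".  Class X10b (= N2) keeps its label CONSTRUCTION-SHAPED / NEEDS X_A3;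
nothing is booked by this file; everything is PER PAIR.  PARTITION (D-0054): X10b∧¬Surj (A5) × p = 3
(the 21 Ш-cells of record) — types-the-object-of; closes NONE.

## What (x10 GEN 41, X10-AUDIT §47; companion of `X10/MuTransferThreeOfFine{,BothRanks,RankOneClassFree}`)

Of the 313 N2 cells, 21 have `9 ∣ #Ш(E/ℚ)_an` (all of analytic rank `0`, `#Ш_an = 9`); the F1-road
records `X10/FineRoadBSDRecords01–30` (292 cells) do not reach them (`hunit` fails).  Their roads of
record are the CTP road (`X10/CasselsTatePairing*`, GEN 19–21: exact `3`-descent `#Sel^(3) = 9` AND a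
non-degenerate alternating Cassels–Tate pairing certificate on `Ш[3]`) and the one-certificate Cha road
(`X10/SelfTwistChaRecords*`, GEN 22–23) — 14 of the 21, all of image `3Ns`; the 7 cells of image `3Nn`
(24649b1, 174887i1, 264992dm1, 288800ba1, 307520ca1, 323008bo1, 453152bq1) carry no per-pair
`BSD(E,3)` record (no `3`-descent engine of the cell reaches the non-split-Cartan image).  On the F1 road
the UPPER half `ord₃ #Ш(E/ℚ) ≤ ord₃ #Ш(E/ℚ)_an` holds at EVERY N2 cell (`missingUpperBoundAt_three_of_fine`,
EITHER image), so a Ш-cell closes per pair from ONE certificate — an exact `3`-descent `#Sel^(3)(E/ℚ) = 9`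
— WITHOUT the Cassels–Tate pairing certificate and without Cassels–Tate squareness: at rank `0` with
`E[3]` irreducible (`3 ∤ #E(ℚ)_tors`), `#(Ш ⊓ H¹(ℚ,E)[3]) = #Sel^(3)` (the tree's
`card_sha_inf_torsionBy_eq_card_selmerGroup_of_rankZero`, Silverman X.4.2 (a)), so `9 ∣ #Ш(E/ℚ)`, i.e.
`ord₃ #Ш ≥ 2 = ord₃ #Ш_an`.

* `nine_dvd_shaOrder_of_card_selmerThree` — rank `0`, `3 ∤ #E(ℚ)_tors`, `#Sel^(3) = 9` ⟹ `9 ∣ #Ш(E/ℚ)`;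
* `missingLowerBoundAt_three_of_card_selmerThree` — the typed LOWER half from it (GZK: rank `0`, `Ш` finite);
* **`bsdp_three_shaCell_of_fine_of_card_selmerThree`** — `3` good ordinary, `E[3]` irreducible,
  `L(E,1) ≠ 0`, EITHER image: F1 ∧ unit-coefficient certificate ∧ `#Sel^(3) = 9` ∧ `ord₃ #Ш_an ≤ 2` ⟹
  Miller's `BSD(E,3)`;
* `MuZeroRoad.bsdp_three_shaCell_of_ainvs_of_fine_of_card_selmerThree` — the literal-model RECORD shape.

Binders: F1 (`hfine`); PUBLISHED `hS` (A35), `hmodP` (A19), `hGZK` (A18), `h3` (A25); certificates `hcertA`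
(μ), `hcard` (exact `3`-descent), `hq`/`hv` (`#Ш_an`, Cremona); census `hL`.  What would close the 7 `3Nn`
Ш-cells per pair on this road: ONE exact `3`-descent `#Sel^(3) = 9` each (a descent engine for the
non-split-Cartan image) — named in `class-closure/N2/WEEK-2026-08-28.md` §5/§6.

References: K. Kato, Astérisque 295 (2004) Thm. 12.6, Thm. 17.4, §17.13 [Kato2004Asterisque]; J. Silverman,
*AEC* (2009) Thm. X.4.2 (a) [SilvermanAEC2009]; R. Greenberg, LNM 1716 (1999) Thm. 4.1 [GreenbergLNM1716];
R. L. Miller, LMS J. Comput. Math. 14 (2011) Def. 1.1 [Miller2011LMS]; B. Mazur, Invent. Math. 44 (1978)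
Prop. 6.3 (1) [Mazur1978].
-/

set_option autoImplicit false

noncomputable section

open scoped Classical MatrixGroups ModularForm

open CongruenceSubgroup WeierstrassCurve Field Literature.NumberTheory.GaloisRepresentations
  Literature.NumberTheory.GaloisCohomology Literature.NumberTheory.EllipticCurves
  Literature.NumberTheory.EllipticCurves.ModularForms Literature.NumberTheory.EllipticCurves.Rank1Residual
  Literature.NumberTheory.EllipticCurves.Rank1Residual.Typed
  Literature.NumberTheory.EllipticCurves.Wuthrich2014
  Literature.NumberTheory.EllipticCurves.Kato2004 Literature.NumberTheory.EllipticCurves.Kato2004.EulerSystemValues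
  Literature.NumberTheory.EllipticCurves.Rank1Residual.X11RankOneCertificates
  Summit.BirchSwinnertonDyer.BirchSwinnertonDyer.Rank1Residual.IntModel
  Summit.BirchSwinnertonDyer.BirchSwinnertonDyer.Rank1Residual.X11RankOne
  Summit.BirchSwinnertonDyer.BirchSwinnertonDyer.Theorems.Rank1ResidualX1Defs
  Summit.BirchSwinnertonDyer.BirchSwinnertonDyer.Rank1Residual

namespace Summit.BirchSwinnertonDyer.Rank1Residual.X10

section ShaCell

variable (W : WeierstrassCurve ℚ) [W.IsElliptic] [W.IsGloballyMinimal]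

omit [W.IsGloballyMinimal] in
/-- **Rank `0`, `3 ∤ #E(ℚ)_tors`, `#Sel^(3)(E/ℚ) = 9` ⟹ `9 ∣ #Ш(E/ℚ)`** (with `#Ш := Nat.card Ш`, so the
statement is also true, trivially, for infinite `Ш`).  The tree's `card_sha_inf_torsionBy_eq_card_selmerGroup_of_rankZero`
(Silverman X.4.2 (a): at rank `0` without rational `3`-torsion the Kummer term of
`0 → E(ℚ)/3 → Sel^(3) → Ш[3] → 0` vanishes) gives `#(Ш ⊓ H¹(ℚ,E)[3]) = 9`, and `Ш ⊓ H¹(ℚ,E)[3] ≤ Ш`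
(`AddSubgroup.card_dvd_of_le`). [cite: SilvermanAEC2009, Thm. X.4.2 (a)] -/
theorem nine_dvd_shaOrder_of_card_selmerThree (hrank : W.mordellWeilRank = 0)
    (htors : ¬ 3 ∣ W.torsionOrder) (hcard : Nat.card (W.selmerGroup (3 : ℤ)) = 9) : 9 ∣ W.shaOrder := by
  haveI : Fact (Nat.Prime 3) := ⟨by norm_num⟩
  have h := card_sha_inf_torsionBy_eq_card_selmerGroup_of_rankZero W 3 hrank htors
  have h9 : Nat.card ↥(W.sha ⊓ AddSubgroup.torsionBy W.galH1 ((3 : ℕ) : ℤ)) = 9 := by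
    rw [h]; exact_mod_cast hcard
  rw [WeierstrassCurve.shaOrder, ← h9]
  exact AddSubgroup.card_dvd_of_le inf_le_left

omit [W.IsGloballyMinimal] in
/-- **The typed LOWER half `ord₃ #Ш(E/ℚ)_an ≤ ord₃ #Ш(E/ℚ)` at a rank-`0` pair with `ord₃ #Ш_an ≤ 2` from
ONE exact `3`-descent `#Sel^(3)(E/ℚ) = 9`** — GZK (`hGZK`) gives rank `0` and `Ш` finite from analytic
rank `0`; `E[3]` irreducible gives `3 ∤ #E(ℚ)_tors` (`padicValNat_torsionOrder_eq_zero_of_irreducible`);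
then `9 ∣ #Ш`.  No Cassels–Tate squareness, no pairing certificate.
[cite: SilvermanAEC2009, Thm. X.4.2 (a)] [cite: Miller2011LMS, Def. 1.1 (arXiv:1010.2431 p. 3)] -/
theorem missingLowerBoundAt_three_of_card_selmerThree
    (hGZK : rank_eq_analyticRank_of_analyticRank_le_one) (hirr : W.HasIrreducibleModPGaloisRep 3)
    (hr0 : W.analyticRank = 0) (hcard : Nat.card (W.selmerGroup (3 : ℤ)) = 9)
    {q : ℚ} (hq : shaAn W = (q : ℂ)) (hv : padicValRat 3 q ≤ 2) : Typed.MissingLowerBoundAt W 3 := by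
  haveI : Fact (Nat.Prime 3) := ⟨by norm_num⟩
  obtain ⟨hrk, hfin⟩ := hGZK W (by omega)
  have hrank : W.mordellWeilRank = 0 := hrk.trans hr0
  have htors : ¬ 3 ∣ W.torsionOrder := by
    intro hd
    have h0 := padicValNat_torsionOrder_eq_zero_of_irreducible W 3 hirr
    rw [padicValNat.eq_zero_iff] at h0
    rcases h0 with h | h | h
    · exact absurd h (by norm_num)
    · exact absurd h W.torsionOrder_pos_holds.ne'
    · exact h hd
  have h9 : 9 ∣ W.shaOrder := nine_dvd_shaOrder_of_card_selmerThree W hrank htors hcard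
  have hn : W.shaOrder ≠ 0 := (WeierstrassCurve.shaOrder_pos W hfin).ne'
  have hle : 2 ≤ padicValNat 3 W.shaOrder := by
    rw [← padicValNat_dvd_iff_le hn]; simpa using h9
  refine ⟨q, hq, hv.trans ?_⟩
  exact_mod_cast hle

/-- **A Ш-CELL on the F1 road: `3` good ordinary, `E[3]` irreducible, `L(E,1) ≠ 0`, EITHER mod-`3` image,
`ord₃ #Ш(E/ℚ)_an ≤ 2`: F1 ∧ the unit-coefficient certificate ∧ ONE exact `3`-descent `#Sel^(3)(E/ℚ) = 9`
⟹ Miller's `BSD(E,3)`.**  Upper half = `missingUpperBoundAt_three_of_fine` (Kato 17.4 from F1 + the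
`μ`-transfer, or the tower if `ρ̄` is onto); lower half = `missingLowerBoundAt_three_of_card_selmerThree`;
GZK assembles.  Binders: F1; PUBLISHED `hS`, `hmodP`, `hGZK`, `h3`; certificates `hcertA`, `hcard`, `hq`/`hv`;
census `hL`.  NO Cassels–Tate pairing certificate, NO Cassels–Tate squareness, NO Wuthrich Prop. 21, NO image
certificate.  Per pair; nothing booked. [cite: Kato2004Asterisque, Thm. 12.6 (p. 222), Thm. 17.4 (2), (3) (p. 273) and §17.13 (pp. 279–280)]
[cite: SilvermanAEC2009, Thm. X.4.2 (a)] [cite: GreenbergLNM1716, §1 Conj. 1.11 and Thm. 4.1 (p. 102)]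
[cite: Miller2011LMS, Def. 1.1 (arXiv:1010.2431 p. 3)] -/
theorem bsdp_three_shaCell_of_fine_of_card_selmerThree
    (hfine : exists_divisibilityInputs_fineQuotient_zeta)
    (hS : Schneider1985_order_charGenerator_odd) (hmodP : nonempty_modularParametrizationData)
    (hGZK : rank_eq_analyticRank_of_analyticRank_le_one)
    (h3 : realPeriodRat_eq_unit_mul_plusPeriod_three)
    (hgood : W.HasGoodReductionAtPrime 3) (hord : ¬ ((3 : ℕ) : ℤ) ∣ W.frobeniusTrace 3)
    (hirr : W.HasIrreducibleModPGaloisRep 3) (hL : W.entireLFunction 1 ≠ 0)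
    (hcertA : ∀ {N : ℕ} [NeZero N] (f : CuspForm (Gamma0 N) 2), IsNewformOf W f →
      ∃ n : ℕ, ‖PowerSeries.coeff n (padicLFunction f (unitRoot W 3 : ℚ_[3]))‖ = 1)
    (hcard : Nat.card (W.selmerGroup (3 : ℤ)) = 9)
    {q : ℚ} (hq : shaAn W = (q : ℂ)) (hv : padicValRat 3 q ≤ 2) : BSDp W 3 := by
  haveI : NeZero (W.conductorNorm ℤ) := ⟨(W.conductorNorm_pos_holds).ne'⟩
  obtain ⟨Dm⟩ := hmodP W
  have hr0 : W.analyticRank = 0 :=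
    (W.analyticRank_eq_zero_iff_holds Dm.isNewformOf.hasEntireLFunction).mpr hL
  exact bsdp_of_missingPPartAt W 3 hGZK (by rw [hr0]; exact Nat.zero_le _)
    (missingPPartAt_of_lower_of_upper W 3
      (missingLowerBoundAt_three_of_card_selmerThree W hGZK hirr hr0 hcard hq hv)
      (missingUpperBoundAt_three_of_fine W hfine hS hmodP hGZK h3 hgood hord hirr hL hcertA))

end ShaCell

/-! ### The same read off a literal integer model — the RECORD shape for a Ш-cell -/

namespace MuZeroRoad

/-- **F1 ∧ unit-coefficient certificate ∧ ONE exact `3`-descent `#Sel^(3)(E/ℚ) = 9` ∧ `ord₃ #Ш(E/ℚ)_an ≤ 2`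
⟹ Miller's `BSD(E,3)`, for a Ш-cell given by a literal integer model** — good ordinary `3` and `E[3]`
irreducible READ OFF the model (`goodOrdIrr_three_of_ainvs_of_countPoints`), EITHER image; then
`bsdp_three_shaCell_of_fine_of_card_selmerThree`.  The shape closes an N2 Ш-cell per pair from the exact
descent ALONE (the CTP pairing certificate of the GEN 19–21 records is not needed on this road).
Census binders per cell: `hL`, `hcertA`, `hcard`, `hq`/`hv`.  Per pair; nothing booked.
[cite: Kato2004Asterisque, Thm. 17.4 (2), (3) (p. 273) and §17.13 (pp. 279–280)] [cite: Mazur1978, §6 Prop. 6.3 (1) (p. 153)]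
[cite: SilvermanAEC2009, Thm. X.4.2 (a)] [cite: Miller2011LMS, Def. 1.1 (arXiv:1010.2431 p. 3)] -/
theorem bsdp_three_shaCell_of_ainvs_of_fine_of_card_selmerThree
    (hfine : exists_divisibilityInputs_fineQuotient_zeta)
    (hS : Schneider1985_order_charGenerator_odd) (hmodP : nonempty_modularParametrizationData)
    (hGZK : rank_eq_analyticRank_of_analyticRank_le_one)
    (h3 : realPeriodRat_eq_unit_mul_plusPeriod_three)
    (a1 a2 a3 a4 a6 : ℤ) {W : WeierstrassCurve ℚ} [W.IsElliptic] [W.IsGloballyMinimal]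
    (hW : integralModelInt W = ⟨a1, a2, a3, a4, a6⟩)
    (ℓ n n3 : ℕ) [Fact ℓ.Prime]
    (h3Δ : ¬ (3 : ℤ) ∣ discOf [a1, a2, a3, a4, a6])
    (hc3 : countPoints [a1, a2, a3, a4, a6] 3 = n3) (hord3 : ¬ (3 : ℤ) ∣ (3 : ℤ) + 1 - n3)
    (hℓ2 : ℓ ≠ 2) (hℓ3 : ℓ ≠ 3) (hℓΔ : ¬ (ℓ : ℤ) ∣ discOf [a1, a2, a3, a4, a6])
    (hc : countPoints [a1, a2, a3, a4, a6] ℓ = n)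
    (hnoroot : ∀ t : ℕ, t < 3 → ¬ (3 : ℤ) ∣ (t : ℤ) ^ 2 - ((ℓ : ℤ) + 1 - n) * t + ℓ)
    (hL : W.entireLFunction 1 ≠ 0)
    (hcertA : ∀ {N : ℕ} [NeZero N] (f : CuspForm (Gamma0 N) 2), IsNewformOf W f →
      ∃ n : ℕ, ‖PowerSeries.coeff n (padicLFunction f (unitRoot W 3 : ℚ_[3]))‖ = 1)
    (hcard : Nat.card (W.selmerGroup (3 : ℤ)) = 9)
    {q : ℚ} (hq : shaAn W = (q : ℂ)) (hv : padicValRat 3 q ≤ 2) : BSDp W 3 := by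
  obtain ⟨hgood, hord, hirr⟩ := goodOrdIrr_three_of_ainvs_of_countPoints a1 a2 a3 a4 a6 hW ℓ n n3 h3Δ
    hc3 hord3 hℓ2 hℓ3 hℓΔ hc hnoroot
  exact bsdp_three_shaCell_of_fine_of_card_selmerThree W hfine hS hmodP hGZK h3 hgood hord hirr hL hcertA
    hcard hq hv

end MuZeroRoad

end Summit.BirchSwinnertonDyer.Rank1Residual.X10

end
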